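import Literature.NumberTheory.Automorphic.LocalLanglandsGL
import HarnessLib

/-!
# The local Langlands correspondence for `GL_n(F)` as a datum, and `rec(π ⊗ |det|^s)`

Trunk: Automorphic (support for the summit statement `Langlands`, lang.S02: local–global
compatibility at every finite place is phrased through the local Langlands correspondence).

Let `F` be a non-archimedean local field. The accepted `LocalLanglandsGL` states the local
Langlands correspondence for the general linear groups over `F` (Harris–Taylor 2001, Thm. A;
Henniart 2000, Thm. 1.2) as the named fact `localLanglands_gl` — the EXISTENCE of a family
`rec_n : Irr(GL_n(F)) → {Frobenius-semisimple n-dimensional Weil–Deligne representations}/≅`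
with the property `IsLocalLanglandsGL F hmul huniq hn hex hns d 𝓔 rec` (bijective; local class
field theory for `n = 1`; `L`- and `ε`-factors of pairs; twists; central characters), normalised
by a local Artin datum `d` (geometric Frobenius ↦ uniformiser) and a system of local constants
`𝓔`, and threading five `LocalGaloisGroup`/`LocalConstants` named facts as hypotheses. A global
statement must *use* `rec_n`; this file bundles everything a use needs into ONE structure, so
that "for the local Langlands correspondence of `F`" becomes "for `L : LocalLanglandsDatum F`":

* `Literature.NumberTheory.Automorphic.LocalLanglandsDatum F` — fields: the six threaded named facts (`hmul huniq hn hex hns`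
  and `hqc : isOpen_ker_quasiChar`, needed to twist classes by `|det|^s`), a local Artin datum
  `artin`, a system of local constants `eps` normalised against it (`eps_artin`), the family
  `recGL` (the name `rec` is Lean's recursor), and the proof
  `isLocalLanglands : IsLocalLanglandsGL F … artin eps recGL`. NOT an unconstrained `Prop`:
  `recGL` is data and `isLocalLanglands` is the accepted six-clause property.
* `LocalLanglandsDatum.nonempty` — named fact: such a datum exists (= Harris–Taylor/Henniart +
  local class field theory + Deligne's local constants + the threaded facts; the accepted
  `localLanglands_gl`, `nonempty_localArtinData`, `nonempty_localEpsilonSystem`).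
* `LocalLanglandsDatum.recTwist L s π` — the class `rec_n(π ⊗ |det|_F^s)` for an irreducible
  smooth `π` (accepted `IrrClass.twist`, `charDet`, `unramifiedTwist F s = |·|_F^s`); with
  `s = (1 - n)/2` this is the Clozel / Harris–Taylor / Taylor normalisation
  `rec(π_v ⊗ |det|^{(1-n)/2})`, `|ϖ|_F = q⁻¹` (accepted `normAbs`, `normAbs_uniformizer`).
  Comparing this class with the Galois side ("`≅ ι WD(ρ|_{Γ_{F_v}})^{F-ss}`") uses the draft
  `WeilDeligneRep.IsTransportAlong` / `HasFrobSemisimpleClass`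
  (`GaloisRepresentations/WeilDeligneOfGalois.lean`), in the summit statement.

Uniqueness caveat (accepted `LocalLanglandsGL`, "Uniqueness"): `IsLocalLanglandsGL` pins `rec_n`
on generic classes only up to what the prelude expresses, and `artin` is *a* local Artin datum;
hence a global statement should quantify `∃ L` once per local field, outside all automorphic and
Galois variables (a wrong normalisation makes global compatibility fail already for `n = 1`), not
`∀ L`. No `sorry`.

## References

* M. Harris, R. Taylor, *The geometry and cohomology of some simple Shimura varieties*, Ann. of
  Math. Stud. 151 (2001), Thm. A, VII.2.20. [HarrisTaylorAMS2001]
* G. Henniart, *Une preuve simple des conjectures de Langlands pour GL(n) sur un corps p-adique*,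
  Invent. Math. 139 (2000), Thm. 1.2. [HenniartInventiones2000]
* J. Tate, *Number theoretic background*, Corvallis 1979, (4.1.2)–(4.1.6). [TateCorvallis1979]
-/

noncomputable section

open scoped MatrixGroups
open Module

namespace Literature.NumberTheory.Automorphic

open Literature.NumberTheory.GaloisRepresentations
open Literature.NumberTheory.GaloisRepresentations.WeilGroup

/-- **The local Langlands correspondence for the general linear groups over `F`, as a datum.**
Bundles: the `LocalGaloisGroup`/`LocalConstants` named facts threaded by the accepted
`IsLocalLanglandsGL` (`hmul huniq hn hex hns`) and `hqc : isOpen_ker_quasiChar` (every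
quasi-character of `Fˣ` has open kernel); a local Artin datum `artin` (geometric Frobenius ↦
uniformiser); Deligne–Langlands local constants `eps` normalised against `artin`; the maps
`recGL n : Irr(GL_n(F)) → {Frob-semisimple n-dim WD reps}/≅`; and the proof that `recGL` IS a local
Langlands correspondence (accepted six-clause `IsLocalLanglandsGL`: bijections, `n = 1` = local
class field theory, `L`/`ε` of pairs, twists, central characters).
[cite: HarrisTaylorAMS2001, Thm. A] [cite: HenniartInventiones2000, Thm. 1.2] -/
structure LocalLanglandsDatum (F : Type) [Field F] [ValuativeRel F] [TopologicalSpace F]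
    [IsNonarchimedeanLocalField F] : Type 1 where
  /-- `deg` is additive on `W_F` (accepted named fact `IsFrobPow.mul`). -/
  hmul : IsFrobPow.mul (F := F)
  /-- `deg` is well defined (accepted named fact `IsFrobPow.unique`). -/
  huniq : IsFrobPow.unique (F := F)
  /-- Inertia is normal in `Γ_F` (accepted named fact). -/
  hn : absInertia_normal F
  /-- Frobenius lifts of every degree exist (accepted named fact). -/
  hex : exists_isFrobPow (F := F)
  /-- Continuous characters of `W_F` are trivial on an open subgroup of inertia (accepted). -/
  hns : WeilGroup.exists_subgroup_le_inertia_isOpen_of_continuous (F := F)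
  /-- Quasi-characters of `Fˣ` have open kernel (accepted named fact `isOpen_ker_quasiChar`). -/
  hqc : isOpen_ker_quasiChar (F := F)
  /-- A local Artin datum (accepted `LocalArtinData`: `W_F →* Fˣ`, geometric Frobenius ↦
  uniformiser, inertia ↦ `𝒪_Fˣ`, kernel = closure of commutators). -/
  artin : LocalArtinData F
  /-- Deligne–Langlands local constants (accepted `LocalEpsilonSystem`). -/
  eps : LocalEpsilonSystem F
  /-- The local constants over `F` itself are normalised against `artin`. -/
  eps_artin : eps.artin F = artin
  /-- The reciprocity maps `rec_n : Irr(GL_n(F)) → {Frobenius-semisimple WD reps of dim n}/≅`. -/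
  recGL : ∀ n : ℕ, IrrClass (GL (Fin n) F) → Quotient (frobSemisimpleWDSetoid F n)
  /-- `recGL` is a local Langlands correspondence (Harris–Taylor 2001, Thm. A (i)–(v)). -/
  isLocalLanglands : IsLocalLanglandsGL F hmul huniq hn hex hns artin eps recGL

namespace LocalLanglandsDatum

/-- **The local Langlands correspondence for `GL_n` exists** (all `n`, every non-archimedean
local field `F` in `Type`): `LocalLanglandsDatum F` is inhabited. Harris–Taylor 2001, Thm. A;
Henniart 2000, Thm. 1.2; with local class field theory (accepted `nonempty_localArtinData`),
Deligne's local constants (accepted `nonempty_localEpsilonSystem`) and the threaded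
`LocalGaloisGroup` facts. Named fact (D-0014). [cite: HarrisTaylorAMS2001, Thm. A]
[cite: HenniartInventiones2000, Thm. 1.2] -/
protected def nonempty : Prop :=
  ∀ (F : Type) [Field F] [ValuativeRel F] [TopologicalSpace F] [IsNonarchimedeanLocalField F],
    Nonempty (LocalLanglandsDatum F)

variable {F : Type} [Field F] [ValuativeRel F] [TopologicalSpace F] [IsNonarchimedeanLocalField F]

/-- A datum yields the accepted existence statement `localLanglands_gl` restricted to its own
normalisation, existence half: `recGL` witnesses `∃ rec, IsLocalLanglandsGL …`. [folklore] -/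
theorem exists_isLocalLanglandsGL (L : LocalLanglandsDatum F) :
    ∃ rec : ∀ n : ℕ, IrrClass (GL (Fin n) F) → Quotient (frobSemisimpleWDSetoid F n),
      IsLocalLanglandsGL F L.hmul L.huniq L.hn L.hex L.hns L.artin L.eps rec :=
  ⟨L.recGL, L.isLocalLanglands⟩

/-- Each `rec_n` of a datum is a bijection (field `bijective` of the accepted property).
[cite: HarrisTaylorAMS2001, Thm. A] -/
theorem recGL_bijective (L : LocalLanglandsDatum F) (n : ℕ) : Function.Bijective (L.recGL n) :=
  L.isLocalLanglands.bijective n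

/-- The character `|det|_F^s : GL_n(F) →* ℂˣ` (accepted `charDet`, `unramifiedTwist F s`;
`|ϖ|_F = q⁻¹`). [cite: TateCorvallis1979, (4.1.6)] -/
def absDetPow (n : ℕ) (s : ℂ) : GL (Fin n) F →* ℂˣ :=
  charDet n (unramifiedTwist F s)

/-- `|det|_F^s` has open kernel (accepted `isOpen_ker_charDet` + the datum's `hqc`). [folklore] -/
theorem isOpen_ker_absDetPow (L : LocalLanglandsDatum F) (n : ℕ) (s : ℂ) :
    IsOpen ((absDetPow (F := F) n s).ker : Set (GL (Fin n) F)) :=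
  isOpen_ker_charDet n (L.hqc _)

/-- **`rec_n(π ⊗ |det|_F^s)`**: the class of the twist of the irreducible smooth `π` by the
smooth character `|det|_F^s` (accepted `IrrClass.twist`) under the datum's `rec_n`. With
`s = (1 - n)/2`: the Clozel / Harris–Taylor normalisation `rec(π_v ⊗ |det|^{(1-n)/2})`.
[cite: HarrisTaylorAMS2001, Thm. A and VII.1] -/
def recTwist (L : LocalLanglandsDatum F) {n : ℕ} (s : ℂ) (π : SmoothIrrep (GL (Fin n) F)) :
    Quotient (frobSemisimpleWDSetoid F n) :=
  L.recGL n (IrrClass.twist (absDetPow n s) (L.isOpen_ker_absDetPow n s) (IrrClass.mk π))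

/-- With `s = 0` no generality is lost on the class level: `recTwist L 0 π` is `rec` of the class
of `π ⊗ 1` (unfolding; `π ⊗ 1 ≅ π`). [folklore] -/
theorem recTwist_zero (L : LocalLanglandsDatum F) {n : ℕ} (π : SmoothIrrep (GL (Fin n) F)) :
    L.recTwist 0 π =
      L.recGL n (IrrClass.mk (π.twist (absDetPow n 0) (L.isOpen_ker_absDetPow n 0))) :=
  rfl

end LocalLanglandsDatum

end Literature.NumberTheory.Automorphic

end
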